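import Summits.Ventures.HSemireg.WedgeHankelRecurrenceTraceForm

/-!
# Venture HSemireg — NUMERATOR RECOVERY AND THE NEWTON–GIRARD IDENTITIES IN SYMBOL FORM: for `m` monic of degree `d` and `deg a < d` the coefficients of the numerator are TRIANGULAR
# combinations of the first `d` values of the symbol, **`[X^{d-1-j}] a = Σ_{i ≤ j} m_{d-i} · dualSeq m a (j − i)`** (`j < d`), the tail obeys **`Σ_{i ≤ d} m_{d-i} · dualSeq m a (j − i) = 0`**
# (`j ≥ d`), and for `a = m′` these are **NEWTON'S IDENTITIES `Σ_{i ≤ j} m_{d-i} p_{j-i} = (d − j) m_{d-j}`** for the power sums `p_k = dualSeq m m′ k = trace (M_X ^ k)` (N103) of an ARBITRARY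
# monic polynomial over ANY field — no roots, no splitting field, no symmetric functions (Mathlib's `MvPolynomial.psum`/`esymm` Newton identities are the universal split case)

HONEST FRAMING. Part of the Lean index of the computation cell `pub-hsemireg` (seat p10 gen 31, Sunday typer «UNIFORM-IN-n»).
LINEAR ALGEBRA OF HANKEL (catalecticant) MATRICES and of polynomials over a field ONLY (`Polynomial.modByMonic`, `Polynomial.divByMonic`, `Polynomial.derivative`, `Matrix.trace`): no variety,
no cohomology theory, no sheaf, no Ext group and no semiregularity map is constructed here; nothing here says that HC / HC_CM / HC_AV holds; no Literature fact is declared or used.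
Custodian versions as in `WedgeHankelSiegelIdeal` (1/3).

WHAT IS IN THE TREE.  N32 (`WedgeHankelRecurrenceDual`): `dualSeq_apply`, `dualSeq_smul`, `dualSeq_X_pow_mul`, `dualSeq_eq_zero_of_dvd`.  N103 (`WedgeHankelRecurrenceTraceForm`): `coeff_divByMonic_X_pow`,
`dualSeq_finset_sum`, `coeff_eq_dualSeq_mul_divByMonic` (Euler's coordinates), `trace_mulResidueMat_X_pow`.  Mathlib: `Polynomial.as_sum_range'`, `as_sum_range_C_mul_X_pow`, `natDegree_divByMonic`,
`coeff_derivative`, `natDegree_derivative_lt`, `Finset.sum_range_reflect`.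
DEDUP ∕ HONESTY: Mathlib's Newton identities (`Mathlib/RingTheory/MvPolynomial/NewtonIdentities`: `MvPolynomial.mul_esymm_eq_sum`, `psum_eq_mul_esymm_sub_sum`) are stated for the power sums
`psum` and elementary symmetric functions `esymm` of finitely many VARIABLES (the universal split case); the PROVED Literature `FieldTheory/FiniteFields/LinearRecurr*` files carry Lidl–Niederreiter's
recurrences for `LinearRecurrence.IsSolution`, not the triangular head `j < d`.  Here the power sums are the symbol `m′/m` of an arbitrary monic `m` (no roots needed) and the identities are read
off Euler's dual basis (N103); `rg` finds no statement of this shape in the tree.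
THIS FILE (namespace `Summit.Ventures.HSemireg.Wedge.HankelOuter` continued; CHAINED on N103; 0 definitions):
* §661 `divByMonic_X_pow_succ_eq_sum` (the tail `m /ₘ X^{k+1} = Σ_{n < d-k} m_{n+k+1} X^n`), **`coeff_eq_sum_coeff_mul_dualSeq`** (`[X^k] a = Σ_{n < d-k} m_{n+k+1} · dualSeq m a n`, `deg a < d`,
  `k < d`), **`sum_coeff_mul_dualSeq_eq_coeff`** (reflected: `Σ_{i ≤ j} m_{d-i} · dualSeq m a (j-i) = [X^{d-1-j}] a`, `j < d`), **`sum_coeff_mul_dualSeq_eq_zero`** (`Σ_{i ≤ d} m_{d-i} · dualSeq m a (j-i) = 0`,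
  `d ≤ j`, any `a`), **`newton_dualSeq_derivative`** (`Σ_{i ≤ j} m_{d-i} · dualSeq m m′ (j-i) = (d − j) · m_{d-j}`, `j < d`), **`newton_trace_pow`** (the same with `trace (M_X ^ (j-i))`, `m` monic of
  degree `t + 1`), `sum_coeff_mul_trace_pow_eq_zero` (`Σ_{i ≤ t+1} m_{t+1-i} · trace (M_X ^ (j-i)) = 0` for `j ≥ t + 1`: Cayley–Hamilton traced).
Nothing Ext-side.  New names only.
-/

open Module Polynomial
open scoped Matrix Polynomial

namespace Summit.Ventures.HSemireg.Wedge.HankelOuter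

open Summit.Ventures.HSemireg.Wedge Summit.Ventures.HSemireg.Wedge.Hankel

variable (K : Type*) [Field K]

/-! ## §661. Numerator recovery and Newton–Girard in symbol form -/

/-- The Euler tail written out: `m /ₘ X^{k+1} = Σ_{n < d-k} m_{n+k+1} X^n` for `k < d = deg m`. -/
theorem divByMonic_X_pow_succ_eq_sum {m : K[X]} {k : ℕ} (hk : k < m.natDegree) :
    m /ₘ Polynomial.X ^ (k + 1) = ∑ n ∈ Finset.range (m.natDegree - k), C (m.coeff (n + k + 1)) * Polynomial.X ^ n := by
  have hdeg : (m /ₘ Polynomial.X ^ (k + 1)).natDegree < m.natDegree - k := by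
    rw [Polynomial.natDegree_divByMonic m (Polynomial.monic_X_pow (k + 1)), Polynomial.natDegree_X_pow]
    omega
  conv_lhs => rw [Polynomial.as_sum_range' _ _ hdeg]
  refine Finset.sum_congr rfl fun n _ => ?_
  rw [← Polynomial.C_mul_X_pow_eq_monomial, coeff_divByMonic_X_pow, show n + (k + 1) = n + k + 1 by omega]

/-- **Numerator recovery: `[X^k] a = Σ_{n < d-k} m_{n+k+1} · dualSeq m a n`** for `m` monic of degree `d`, `deg a < d`, `k < d` — the coefficients of the numerator of a symbol `a/m` are triangular
combinations of its first `d` values (Euler's coordinates N103 with the tail written out). -/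
theorem coeff_eq_sum_coeff_mul_dualSeq {m : K[X]} (hm : m.Monic) {a : K[X]} (ha : a.natDegree < m.natDegree) {k : ℕ} (hk : k < m.natDegree) :
    a.coeff k = ∑ n ∈ Finset.range (m.natDegree - k), m.coeff (n + k + 1) * dualSeq K m a n := by
  rw [coeff_eq_dualSeq_mul_divByMonic K hm ha hk, divByMonic_X_pow_succ_eq_sum K hk, Finset.mul_sum, dualSeq_finset_sum, Finset.sum_apply]
  refine Finset.sum_congr rfl fun n _ => ?_
  rw [mul_left_comm, Polynomial.C_mul', dualSeq_smul, Pi.smul_apply, smul_eq_mul, mul_comm a, dualSeq_X_pow_mul, zero_add]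

/-- **Reflected form: `Σ_{i ≤ j} m_{d-i} · dualSeq m a (j − i) = [X^{d-1-j}] a`** (`m` monic of degree `d`, `deg a < d`, `j < d`) — the triangular Toeplitz system `a = (m · (a/m))_{+}` read
coefficientwise. -/
theorem sum_coeff_mul_dualSeq_eq_coeff {m : K[X]} (hm : m.Monic) {a : K[X]} (ha : a.natDegree < m.natDegree) {j : ℕ} (hj : j < m.natDegree) :
    ∑ i ∈ Finset.range (j + 1), m.coeff (m.natDegree - i) * dualSeq K m a (j - i) = a.coeff (m.natDegree - 1 - j) := by
  rw [coeff_eq_sum_coeff_mul_dualSeq K hm ha (by omega : m.natDegree - 1 - j < m.natDegree), show m.natDegree - (m.natDegree - 1 - j) = j + 1 by omega,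
    ← Finset.sum_range_reflect _ (j + 1)]
  refine Finset.sum_congr rfl fun i hi => ?_
  rw [Finset.mem_range] at hi
  rw [show j + 1 - 1 - i = j - i by omega, show m.natDegree - (j - i) = i + (m.natDegree - 1 - j) + 1 by omega, show j - (j - i) = i by omega]

/-- **The tail: `Σ_{i ≤ d} m_{d-i} · dualSeq m a (j − i) = 0` for `j ≥ d`** (`m` monic of degree `d`, ANY `a`): this is `dualSeq m (m · X^{j-d} a) 0 = 0`, the recurrence with characteristic
polynomial `m` written as a convolution. -/
theorem sum_coeff_mul_dualSeq_eq_zero {m : K[X]} (hm : m.Monic) (a : K[X]) {j : ℕ} (hj : m.natDegree ≤ j) :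
    ∑ i ∈ Finset.range (m.natDegree + 1), m.coeff (m.natDegree - i) * dualSeq K m a (j - i) = 0 := by
  set d := m.natDegree with hd
  have hterm : ∀ l ∈ Finset.range (d + 1), m.coeff l * dualSeq K m a (j - d + l) = dualSeq K m (C (m.coeff l) * Polynomial.X ^ l * (Polynomial.X ^ (j - d) * a)) 0 := by
    intro l _
    rw [mul_assoc, Polynomial.C_mul', dualSeq_smul, Pi.smul_apply, smul_eq_mul, dualSeq_X_pow_mul, zero_add, dualSeq_X_pow_mul, add_comm]
  calc ∑ i ∈ Finset.range (d + 1), m.coeff (d - i) * dualSeq K m a (j - i)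
      = ∑ l ∈ Finset.range (d + 1), m.coeff l * dualSeq K m a (j - d + l) := by
        rw [← Finset.sum_range_reflect _ (d + 1)]
        refine Finset.sum_congr rfl fun i hi => ?_
        rw [Finset.mem_range] at hi
        rw [show d + 1 - 1 - i = d - i by omega, show d - (d - i) = i by omega, show j - (d - i) = j - d + i by omega]
    _ = dualSeq K m ((∑ l ∈ Finset.range (d + 1), C (m.coeff l) * Polynomial.X ^ l) * (Polynomial.X ^ (j - d) * a)) 0 := by
        rw [Finset.sum_mul, dualSeq_finset_sum, Finset.sum_apply]
        exact Finset.sum_congr rfl hterm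
    _ = 0 := by
        rw [← Polynomial.as_sum_range_C_mul_X_pow m, dualSeq_eq_zero_of_dvd K hm (dvd_mul_right m _), Pi.zero_apply]

/-- **NEWTON'S IDENTITIES in symbol form: `Σ_{i ≤ j} m_{d-i} · p_{j-i} = (d − j) · m_{d-j}` for `j < d`**, where `p_k = dualSeq m m′ k` is the `k`-th value of the symbol `m′/m` (= `trace (M_X^k)`
by N103, = the `k`-th power sum of the roots when `m` splits by N80) — `m` an ARBITRARY monic polynomial of degree `d` over ANY field (numerator recovery for `a = m′`, whose coefficients are
`[X^{d-1-j}] m′ = (d − j) m_{d-j}`). -/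
theorem newton_dualSeq_derivative {m : K[X]} (hm : m.Monic) {j : ℕ} (hj : j < m.natDegree) :
    ∑ i ∈ Finset.range (j + 1), m.coeff (m.natDegree - i) * dualSeq K m (derivative m) (j - i) = ((m.natDegree - j : ℕ) : K) * m.coeff (m.natDegree - j) := by
  have hd : (derivative m).natDegree < m.natDegree := Polynomial.natDegree_derivative_lt (by omega)
  rw [sum_coeff_mul_dualSeq_eq_coeff K hm hd hj, Polynomial.coeff_derivative, show m.natDegree - 1 - j + 1 = m.natDegree - j by omega, mul_comm, ← Nat.cast_succ,
    show (m.natDegree - 1 - j).succ = m.natDegree - j by omega]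

/-- **NEWTON'S IDENTITIES for the traces of the powers of the companion ∕ shift matrix: `Σ_{i ≤ j} m_{t+1-i} · trace (M_X ^ (j − i)) = (t + 1 − j) · m_{t+1-j}` for `j ≤ t`** (`m` monic of
degree `t + 1`, `M_X = mulResidueMat m X`, any field; N103 `trace_mulResidueMat_X_pow` + the previous theorem). -/
theorem newton_trace_pow {t : ℕ} {m : K[X]} (hm : m.Monic) (hmd : m.natDegree = t + 1) {j : ℕ} (hj : j ≤ t) :
    ∑ i ∈ Finset.range (j + 1), m.coeff (t + 1 - i) * ((mulResidueMat K t m Polynomial.X) ^ (j - i)).trace = ((t + 1 - j : ℕ) : K) * m.coeff (t + 1 - j) := by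
  have h := newton_dualSeq_derivative K hm (show j < m.natDegree by omega)
  rw [hmd] at h
  rw [← h]
  exact Finset.sum_congr rfl fun i _ => by rw [trace_mulResidueMat_X_pow K hm hmd]

/-- **Cayley–Hamilton traced: `Σ_{i ≤ t+1} m_{t+1-i} · trace (M_X ^ (j − i)) = 0` for `j ≥ t + 1`** (`m` monic of degree `t + 1`; the tail identity for `a = m′`). -/
theorem sum_coeff_mul_trace_pow_eq_zero {t : ℕ} {m : K[X]} (hm : m.Monic) (hmd : m.natDegree = t + 1) {j : ℕ} (hj : t + 1 ≤ j) :
    ∑ i ∈ Finset.range (t + 2), m.coeff (t + 1 - i) * ((mulResidueMat K t m Polynomial.X) ^ (j - i)).trace = 0 := by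
  have h := sum_coeff_mul_dualSeq_eq_zero K hm (derivative m) (show m.natDegree ≤ j by omega)
  rw [hmd] at h
  rw [← h]
  exact Finset.sum_congr rfl fun i _ => by rw [trace_mulResidueMat_X_pow K hm hmd]

end Summit.Ventures.HSemireg.Wedge.HankelOuter
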